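/-
Origin: written from primary sources — R. Howe, *θ-series and invariant theory*, Proc. Sympos. Pure
Math. 33.1 (1979) §2–§3 (restriction of the oscillator representation to a see-saw sub-pair is the
tensor product of the small oscillator representations up to a character); S. Kudla, *Seesaw dual
reductive pairs* (Katata 1983), Progr. Math. 46 (1984) §1; S. Gelbart, J. Rogawski, Invent. Math.
105 (1991) §3.1, Remark p. 457 (two compatible splittings differ by a character with values in
the centre). Adapted: no. The content of this file is elementary linear algebra and group theory:
the scalars of a per-element two-factor Schur statement along three representations of a group
form a CHARACTER, a character of a see-saw product group `GV × (U₁ × U₂)` factors into three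
characters, and twisting the representations by these characters ("renormalising the splittings")
makes the restriction identity hold with scalar `1`. The analytic input (existence of the scalars)
is the hypothesis `h` throughout; nothing analytic is proved or assumed otherwise.
-/
import Mathlib.RepresentationTheory.Basic
import HarnessLib

/-!
# The see-saw scalar is a character; renormalised representations restrict on the nose

Setting: a field `R`, a bilinear map `t : S₁ →ₗ[R] S₂ →ₗ[R] S` (model case: the external tensor of
Schwartz–Bruhat functions `𝒮(X₁) × 𝒮(X₂) → 𝒮(X₁ ⊕ X₂)`), a monoid / group `G` and three
representations `M : G →* End S`, `A₁ : G →* End S₁`, `A₂ : G →* End S₂` (model case: the oscillator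
representation of a dual pair `(U(V), U(W₁ ⊕ W₂))` restricted to the see-saw sub-pair, and the two
small oscillator representations of `(U(V), U(W_j))`), and the per-element two-factor Schur statement

  `h : ∀ g, ∃ c ≠ 0, ∀ a b, M g (t a b) = c • t (A₁ g a) (A₂ g b)`

(R. Howe 1979 §2–§3: "the restriction of the oscillator representation to a see-saw pair is the
tensor product of the small oscillator representations up to a character"; here a HYPOTHESIS).

* `SeesawScalar.scalarFun t M A₁ A₂ h : G → R` — the scalar family (choice); `scalarFun_spec`,
  `scalarFun_ne_zero`, uniqueness `scalarFun_eq`, `scalarFun_one`, `scalarFun_mul`;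
* for a GROUP `G` and one pair with `t a b ≠ 0` (`exists_apply_ne_zero`):
  **`SeesawScalar.scalarChar … : G →* Rˣ`** — the scalars form a character (`coe_scalarChar`,
  `scalarChar_spec`, `coe_scalarChar_eq`);
* `SeesawScalar.twist χ ρ` — the twist `g ↦ χ(g) • ρ(g)` of a representation by a character
  `χ : G →* Rˣ`, again a representation; `twist_apply`, `twist_apply_of_eq_one`, `twist_twist`,
  `twist_one`.  (Mathlib has no such `twist`; the tree's `Literature/AlgebraicGeometry/Motives/GaloisRealization`
  has `twistRep χ ρ j = χ^j • ρ` for Tate twists, `j : ℤ`, whose `j = 1` case agrees with `twist` pointwise by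
  `zpow_one` — not imported here to keep this elementary file free of the Galois-representation imports);
* RENORMALISATION identities with scalar `1`: `twist_inv_scalarChar_apply_tensor` (twist `M` by
  `χ⁻¹`, keep `A₁, A₂`); and for the see-saw product group `G = GV × (U₁ × U₂)` with `A_j`
  representations of `GV × U_j` (`seesawFst`, `seesawSnd`, `seesawInl`, `seesawInr₂`): the
  factorisation `χ(g,(u₁,u₂)) = λV g · λ₁ u₁ · λ₂ u₂` (`char_seesaw_factor`,
  `seesawScalarChar_factor`; characters `charV`, `char₁`, `char₂`, `charSmall₁ = λV ⊠ λ₁`,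
  `charSmall₂`, `charBigV`, `charBig₁`), **`seesaw_restrict_twist_small`** (keep `M`; twist `A₁` by
  `(g,u₁) ↦ λV g · λ₁ u₁`, `A₂` by `(g,u₂) ↦ λ₂ u₂`) and **`seesaw_restrict_twist_big`** (twist `M` by
  `λV⁻¹` on the `GV`-factor and `A_j` by `λ_j` on the `U_j`-factor — the scheme
  «`s_V^W ↦ s_V^W · λ_V⁻¹`, `s_{W_j} ↦ s_{W_j} · λ_j`» of [GelbartRogawski1991] p. 457-type twists).

## What this file deliberately does NOT decide

Which renormalisation scheme a consumer uses; the file records the cost of each in kernel form: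
under `twist_small` the small representations change by `(g,u₁) ↦ λV g · λ₁ u₁` and `(g,u₂) ↦ λ₂ u₂`
(the big one is untouched); under `twist_big` the big one changes by `λV⁻¹` on `GV` and the small
ones by `λ_j` on `U_j` only; under `twist χ⁻¹ M` only the big one changes.  Wherever the character is
`1` (e.g. at elements whose three operators fix an invariant multiplicative functional — the adelic
sequel `NumberTheory/Automorphic/AdelicSchwartzBruhatTensorCharacter` proves this at `Θ`-fixing
elements) every scheme leaves the operators untouched (`twist_apply_of_eq_one`).  All statements are
kernel-proved, tagged `[folklore]`.
-/

namespace Literature.RepresentationTheory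

namespace SeesawScalar

variable {R : Type*} [Field R] {S₁ S₂ S : Type*} [AddCommGroup S₁] [Module R S₁]
  [AddCommGroup S₂] [Module R S₂] [AddCommGroup S] [Module R S]

/-! ### The scalar family of a per-element two-factor Schur statement -/

section Monoid

variable {G : Type*} [Monoid G] (t : S₁ →ₗ[R] S₂ →ₗ[R] S)
  (M : Representation R G S) (A₁ : Representation R G S₁) (A₂ : Representation R G S₂)

/-- The scalar family `g ↦ c(g)` attached to a per-element two-factor Schur statement
`∀ g, ∃ c ≠ 0, ∀ a b, M g (t a b) = c • t (A₁ g a) (A₂ g b)` (a choice; unique by `scalarFun_eq`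
wherever some `t (A₁ g a) (A₂ g b) ≠ 0`). [folklore] -/
noncomputable def scalarFun
    (h : ∀ g : G, ∃ c : R, c ≠ 0 ∧ ∀ a b, M g (t a b) = c • t (A₁ g a) (A₂ g b)) (g : G) : R :=
  Classical.choose (h g)

variable (h : ∀ g : G, ∃ c : R, c ≠ 0 ∧ ∀ a b, M g (t a b) = c • t (A₁ g a) (A₂ g b))

/-- The chosen scalar is nonzero. [folklore] -/
theorem scalarFun_ne_zero (g : G) : scalarFun t M A₁ A₂ h g ≠ 0 :=
  (Classical.choose_spec (h g)).1

/-- The defining identity `M g (t a b) = c(g) • t (A₁ g a) (A₂ g b)`. [folklore] -/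
theorem scalarFun_spec (g : G) (a : S₁) (b : S₂) :
    M g (t a b) = scalarFun t M A₁ A₂ h g • t (A₁ g a) (A₂ g b) :=
  (Classical.choose_spec (h g)).2 a b

/-- Uniqueness: any scalar satisfying the identity at `g` equals `c(g)`, provided one value
`t (A₁ g a) (A₂ g b)` is nonzero. [folklore] -/
theorem scalarFun_eq {g : G} (hne : ∃ a b, t (A₁ g a) (A₂ g b) ≠ 0) {c : R}
    (hc : ∀ a b, M g (t a b) = c • t (A₁ g a) (A₂ g b)) : scalarFun t M A₁ A₂ h g = c := by
  obtain ⟨a, b, hab⟩ := hne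
  exact smul_left_injective R hab ((scalarFun_spec t M A₁ A₂ h g a b).symm.trans (hc a b))

/-- `c(1) = 1` (as soon as `t` is not identically zero). [folklore] -/
theorem scalarFun_one (hne : ∃ a b, t a b ≠ 0) : scalarFun t M A₁ A₂ h 1 = 1 := by
  apply scalarFun_eq t M A₁ A₂ h
  · simpa only [map_one, Module.End.one_apply] using hne
  · intro a b
    simp only [map_one, Module.End.one_apply, one_smul]

/-- **Multiplicativity** `c(g g') = c(g) c(g')`, provided one value `t (A₁ (g g') a) (A₂ (g g') b)` is
nonzero. (cf. R. Howe, θ-series and invariant theory (1979) §3) [folklore] -/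
theorem scalarFun_mul (g g' : G) (hne : ∃ a b, t (A₁ (g * g') a) (A₂ (g * g') b) ≠ 0) :
    scalarFun t M A₁ A₂ h (g * g') = scalarFun t M A₁ A₂ h g * scalarFun t M A₁ A₂ h g' := by
  apply scalarFun_eq t M A₁ A₂ h hne
  intro a b
  rw [map_mul, map_mul, map_mul, Module.End.mul_apply, Module.End.mul_apply, Module.End.mul_apply,
    scalarFun_spec t M A₁ A₂ h g', map_smul, scalarFun_spec t M A₁ A₂ h g, smul_smul, mul_comm]

end Monoid

/-! ### Over a group: the scalars form a character -/

section Group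

variable {G : Type*} [Group G] (t : S₁ →ₗ[R] S₂ →ₗ[R] S)
  (M : Representation R G S) (A₁ : Representation R G S₁) (A₂ : Representation R G S₂)
  (h : ∀ g : G, ∃ c : R, c ≠ 0 ∧ ∀ a b, M g (t a b) = c • t (A₁ g a) (A₂ g b))

/-- Over a group every `A_j g` is invertible, so ONE pair with `t a b ≠ 0` gives, for every `g`, a pair
with `t (A₁ g a') (A₂ g b') ≠ 0`. [folklore] -/
theorem exists_apply_ne_zero (hne : ∃ a b, t a b ≠ 0) (g : G) :
    ∃ a b, t (A₁ g a) (A₂ g b) ≠ 0 := by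
  obtain ⟨a, b, hab⟩ := hne
  refine ⟨A₁ g⁻¹ a, A₂ g⁻¹ b, ?_⟩
  rwa [← Module.End.mul_apply, ← map_mul, mul_inv_cancel, map_one, Module.End.one_apply,
    ← Module.End.mul_apply, ← map_mul, mul_inv_cancel, map_one, Module.End.one_apply]

/-- **The see-saw scalars form a character** `G →* Rˣ` (group case; `t` not identically zero).
(cf. R. Howe (1979) §3; S. Kudla, Seesaw dual reductive pairs (1984) §1) [folklore] -/
noncomputable def scalarChar (hne : ∃ a b, t a b ≠ 0) : G →* Rˣ where
  toFun g := Units.mk0 (scalarFun t M A₁ A₂ h g) (scalarFun_ne_zero t M A₁ A₂ h g)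
  map_one' := Units.ext (by rw [Units.val_mk0, Units.val_one]; exact scalarFun_one t M A₁ A₂ h hne)
  map_mul' g g' := Units.ext (by
    rw [Units.val_mk0, Units.val_mul, Units.val_mk0, Units.val_mk0]
    exact scalarFun_mul t M A₁ A₂ h g g' (exists_apply_ne_zero t A₁ A₂ hne _))

variable (hne : ∃ a b, t a b ≠ 0)

/-- The value of the character is the scalar. [folklore] -/
@[simp] theorem coe_scalarChar (g : G) :
    (scalarChar t M A₁ A₂ h hne g : R) = scalarFun t M A₁ A₂ h g := rfl

/-- The defining identity through the character: `M g (t a b) = χ(g) • t (A₁ g a) (A₂ g b)`.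
[folklore] -/
theorem scalarChar_spec (g : G) (a : S₁) (b : S₂) :
    M g (t a b) = (scalarChar t M A₁ A₂ h hne g : R) • t (A₁ g a) (A₂ g b) :=
  scalarFun_spec t M A₁ A₂ h g a b

/-- Uniqueness through the character. [folklore] -/
theorem coe_scalarChar_eq {g : G} {c : R} (hc : ∀ a b, M g (t a b) = c • t (A₁ g a) (A₂ g b)) :
    (scalarChar t M A₁ A₂ h hne g : R) = c :=
  scalarFun_eq t M A₁ A₂ h (exists_apply_ne_zero t A₁ A₂ hne g) hc

end Group

/-! ### Twisting a representation by a character -/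

section Twist

variable {G : Type*} [Monoid G] {V : Type*} [AddCommGroup V] [Module R V]

/-- **Twist of a representation by a character**: `g ↦ χ(g) • ρ(g)`; again a representation (scalars are
central in `End V`).  In the model case: changing a splitting of the metaplectic cover over `G` by the
central-valued character `χ` ([GelbartRogawski1991] §3.1, Remark p. 457). [folklore] -/
def twist (χ : G →* Rˣ) (ρ : Representation R G V) : Representation R G V where
  toFun g := (χ g : R) • ρ g
  map_one' := by rw [map_one, map_one, Units.val_one, one_smul]
  map_mul' g g' := by rw [map_mul, map_mul, Units.val_mul, smul_mul_smul_comm]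

/-- Values of the twist. [folklore] -/
@[simp] theorem twist_apply (χ : G →* Rˣ) (ρ : Representation R G V) (g : G) (v : V) :
    twist χ ρ g v = (χ g : R) • ρ g v := rfl

/-- Where the character is `1` the twist agrees with the original. [folklore] -/
theorem twist_apply_of_eq_one {χ : G →* Rˣ} (ρ : Representation R G V) {g : G} (hg : χ g = 1) :
    twist χ ρ g = ρ g := by
  ext v
  rw [twist_apply, hg, Units.val_one, one_smul]

/-- Twisting by `χ` then by `χ'` is twisting by `χ * χ'`. [folklore] -/
theorem twist_twist (χ χ' : G →* Rˣ) (ρ : Representation R G V) :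
    twist χ (twist χ' ρ) = twist (χ * χ') ρ := by
  ext g v
  simp only [twist_apply, MonoidHom.mul_apply, Units.val_mul, smul_smul]

/-- Twisting by the trivial character does nothing. [folklore] -/
@[simp] theorem twist_one (ρ : Representation R G V) : twist (1 : G →* Rˣ) ρ = ρ := by
  ext g v
  simp only [twist_apply, MonoidHom.one_apply, Units.val_one, one_smul]

end Twist

/-! ### Renormalisation I: absorb the whole character into the big representation -/

section RenormBig

variable {G : Type*} [Group G] (t : S₁ →ₗ[R] S₂ →ₗ[R] S)
  (M : Representation R G S) (A₁ : Representation R G S₁) (A₂ : Representation R G S₂)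
  (h : ∀ g : G, ∃ c : R, c ≠ 0 ∧ ∀ a b, M g (t a b) = c • t (A₁ g a) (A₂ g b))
  (hne : ∃ a b, t a b ≠ 0)

/-- **On the nose, scheme (M)**: twisting the big representation by `χ⁻¹` (and keeping `A₁, A₂`)
gives `M′ g (t a b) = t (A₁ g a) (A₂ g b)` for all `g, a, b`. [folklore] -/
theorem twist_inv_scalarChar_apply_tensor (g : G) (a : S₁) (b : S₂) :
    twist (scalarChar t M A₁ A₂ h hne)⁻¹ M g (t a b) = t (A₁ g a) (A₂ g b) := by
  rw [twist_apply, scalarChar_spec t M A₁ A₂ h hne g a b, smul_smul, MonoidHom.inv_apply,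
    Units.inv_mul, one_smul]

end RenormBig

/-! ### The see-saw product group `GV × (U₁ × U₂)` -/

section Seesaw

variable (GV U₁ U₂ : Type*) [Group GV] [Group U₁] [Group U₂]

/-- The projection `GV × (U₁ × U₂) →* GV × U₁`, `(g,(u₁,u₂)) ↦ (g,u₁)` (the first small pair inside
the see-saw sub-pair). [folklore] -/
def seesawFst : GV × (U₁ × U₂) →* GV × U₁ :=
  (MonoidHom.fst GV (U₁ × U₂)).prod ((MonoidHom.fst U₁ U₂).comp (MonoidHom.snd GV (U₁ × U₂)))

/-- The projection `GV × (U₁ × U₂) →* GV × U₂`, `(g,(u₁,u₂)) ↦ (g,u₂)`. [folklore] -/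
def seesawSnd : GV × (U₁ × U₂) →* GV × U₂ :=
  (MonoidHom.fst GV (U₁ × U₂)).prod ((MonoidHom.snd U₁ U₂).comp (MonoidHom.snd GV (U₁ × U₂)))

/-- The embedding `GV × U₁ →* GV × (U₁ × U₂)`, `(g,u₁) ↦ (g,(u₁,1))`. [folklore] -/
def seesawInl : GV × U₁ →* GV × (U₁ × U₂) :=
  (MonoidHom.fst GV U₁).prod ((MonoidHom.inl U₁ U₂).comp (MonoidHom.snd GV U₁))

/-- The embedding `U₂ →* GV × (U₁ × U₂)`, `u₂ ↦ (1,(1,u₂))`. [folklore] -/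
def seesawInr₂ : U₂ →* GV × (U₁ × U₂) :=
  (MonoidHom.inr GV (U₁ × U₂)).comp (MonoidHom.inr U₁ U₂)

variable {GV U₁ U₂}

/-- Unfolding. [folklore] -/
@[simp] theorem seesawFst_apply (g : GV) (u₁ : U₁) (u₂ : U₂) :
    seesawFst GV U₁ U₂ (g, (u₁, u₂)) = (g, u₁) := rfl

/-- Unfolding. [folklore] -/
@[simp] theorem seesawSnd_apply (g : GV) (u₁ : U₁) (u₂ : U₂) :
    seesawSnd GV U₁ U₂ (g, (u₁, u₂)) = (g, u₂) := rfl

/-- Unfolding. [folklore] -/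
@[simp] theorem seesawInl_apply (g : GV) (u₁ : U₁) :
    seesawInl GV U₁ U₂ (g, u₁) = (g, (u₁, 1)) := rfl

/-- Unfolding. [folklore] -/
@[simp] theorem seesawInr₂_apply (u₂ : U₂) :
    seesawInr₂ GV U₁ U₂ u₂ = (1, (1, u₂)) := rfl

/-- `(g,(u₁,u₂)) = (g,(u₁,1)) · (1,(1,u₂))` in the product group. [folklore] -/
theorem seesaw_mk_eq_mul (g : GV) (u₁ : U₁) (u₂ : U₂) :
    ((g, (u₁, u₂)) : GV × (U₁ × U₂)) = seesawInl GV U₁ U₂ (g, u₁) * seesawInr₂ GV U₁ U₂ u₂ := by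
  simp only [seesawInl_apply, seesawInr₂_apply, Prod.mk_mul_mk, mul_one, one_mul]

/-- `(g,(u₁,1)) = (g,(1,1)) · (1,(u₁,1))`. [folklore] -/
theorem seesawInl_eq_mul (g : GV) (u₁ : U₁) :
    seesawInl GV U₁ U₂ (g, u₁) =
      ((g, ((1 : U₁), (1 : U₂))) : GV × (U₁ × U₂)) * ((1 : GV), (u₁, (1 : U₂))) := by
  simp only [seesawInl_apply, Prod.mk_mul_mk, mul_one, one_mul]

/-- **Factorisation of a character of the see-saw product group**:
`χ(g,(u₁,u₂)) = χ(g,(1,1)) · χ(1,(u₁,1)) · χ(1,(1,u₂))`. [folklore] -/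
theorem char_seesaw_factor {C : Type*} [CommMonoid C] (χ : GV × (U₁ × U₂) →* C) (g : GV) (u₁ : U₁)
    (u₂ : U₂) :
    χ (g, (u₁, u₂)) = χ (g, (1, 1)) * χ (1, (u₁, 1)) * χ (1, (1, u₂)) := by
  rw [seesaw_mk_eq_mul, map_mul, seesawInl_eq_mul, map_mul, seesawInr₂_apply]

/-- Coarser factorisation `χ(g,(u₁,u₂)) = χ(g,(u₁,1)) · χ(1,(1,u₂))`. [folklore] -/
theorem char_seesaw_factor₂ {C : Type*} [CommMonoid C] (χ : GV × (U₁ × U₂) →* C) (g : GV) (u₁ : U₁)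
    (u₂ : U₂) :
    χ (g, (u₁, u₂)) = χ (seesawInl GV U₁ U₂ (g, u₁)) * χ (seesawInr₂ GV U₁ U₂ u₂) := by
  rw [seesaw_mk_eq_mul, map_mul]

variable (t : S₁ →ₗ[R] S₂ →ₗ[R] S) (M : Representation R (GV × (U₁ × U₂)) S)
  (A₁ : Representation R (GV × U₁) S₁) (A₂ : Representation R (GV × U₂) S₂)
  (h : ∀ p : GV × (U₁ × U₂), ∃ c : R, c ≠ 0 ∧ ∀ a b,
    M p (t a b) = c • t (A₁ (seesawFst GV U₁ U₂ p) a) (A₂ (seesawSnd GV U₁ U₂ p) b))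
  (hne : ∃ a b, t a b ≠ 0)

/-- **The see-saw character** of the triple `(M, A₁, A₂)` on `GV × (U₁ × U₂)`: the character of
`(M, A₁ ∘ seesawFst, A₂ ∘ seesawSnd)`. (cf. S. Kudla, Seesaw dual reductive pairs (1984) §1)
[folklore] -/
noncomputable def seesawScalarChar : GV × (U₁ × U₂) →* Rˣ :=
  scalarChar t M (A₁.comp (seesawFst GV U₁ U₂)) (A₂.comp (seesawSnd GV U₁ U₂)) h hne

/-- The defining identity in see-saw form:
`M (g,(u₁,u₂)) (t a b) = χ(g,(u₁,u₂)) • t (A₁ (g,u₁) a) (A₂ (g,u₂) b)`. [folklore] -/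
theorem seesawScalarChar_spec (g : GV) (u₁ : U₁) (u₂ : U₂) (a : S₁) (b : S₂) :
    M (g, (u₁, u₂)) (t a b) =
      (seesawScalarChar t M A₁ A₂ h hne (g, (u₁, u₂)) : R) • t (A₁ (g, u₁) a) (A₂ (g, u₂) b) :=
  scalarChar_spec t M (A₁.comp (seesawFst GV U₁ U₂)) (A₂.comp (seesawSnd GV U₁ U₂)) h hne _ a b

/-- `λV : GV →* Rˣ`, `g ↦ χ(g,(1,1))` — the discrepancy on the common member of the see-saw. [folklore] -/
noncomputable def charV : GV →* Rˣ :=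
  (seesawScalarChar t M A₁ A₂ h hne).comp (MonoidHom.inl GV (U₁ × U₂))

/-- `λ₁ : U₁ →* Rˣ`, `u₁ ↦ χ(1,(u₁,1))`. [folklore] -/
noncomputable def char₁ : U₁ →* Rˣ :=
  (seesawScalarChar t M A₁ A₂ h hne).comp ((MonoidHom.inr GV (U₁ × U₂)).comp (MonoidHom.inl U₁ U₂))

/-- `λ₂ : U₂ →* Rˣ`, `u₂ ↦ χ(1,(1,u₂))`. [folklore] -/
noncomputable def char₂ : U₂ →* Rˣ :=
  (seesawScalarChar t M A₁ A₂ h hne).comp (seesawInr₂ GV U₁ U₂)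

/-- Unfolding. [folklore] -/
@[simp] theorem charV_apply (g : GV) :
    charV t M A₁ A₂ h hne g = seesawScalarChar t M A₁ A₂ h hne (g, (1, 1)) := rfl

/-- Unfolding. [folklore] -/
@[simp] theorem char₁_apply (u₁ : U₁) :
    char₁ t M A₁ A₂ h hne u₁ = seesawScalarChar t M A₁ A₂ h hne (1, (u₁, 1)) := rfl

/-- Unfolding. [folklore] -/
@[simp] theorem char₂_apply (u₂ : U₂) :
    char₂ t M A₁ A₂ h hne u₂ = seesawScalarChar t M A₁ A₂ h hne (1, (1, u₂)) := rfl

/-- **`χ(g,(u₁,u₂)) = λV g · λ₁ u₁ · λ₂ u₂`.** [folklore] -/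
theorem seesawScalarChar_factor (g : GV) (u₁ : U₁) (u₂ : U₂) :
    seesawScalarChar t M A₁ A₂ h hne (g, (u₁, u₂)) =
      charV t M A₁ A₂ h hne g * char₁ t M A₁ A₂ h hne u₁ * char₂ t M A₁ A₂ h hne u₂ :=
  char_seesaw_factor _ g u₁ u₂

/-- The character of the first small pair under scheme (small): `(g,u₁) ↦ χ(g,(u₁,1)) = λV g · λ₁ u₁`.
[folklore] -/
noncomputable def charSmall₁ : GV × U₁ →* Rˣ :=
  (seesawScalarChar t M A₁ A₂ h hne).comp (seesawInl GV U₁ U₂)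

/-- The character of the second small pair under scheme (small): `(g,u₂) ↦ λ₂ u₂`. [folklore] -/
noncomputable def charSmall₂ : GV × U₂ →* Rˣ :=
  (char₂ t M A₁ A₂ h hne).comp (MonoidHom.snd GV U₂)

/-- Unfolding. [folklore] -/
@[simp] theorem charSmall₁_apply (g : GV) (u₁ : U₁) :
    charSmall₁ t M A₁ A₂ h hne (g, u₁) = seesawScalarChar t M A₁ A₂ h hne (g, (u₁, 1)) := rfl

/-- `(g,u₁) ↦ λV g · λ₁ u₁`, explicitly. [folklore] -/
theorem charSmall₁_apply_eq_mul (g : GV) (u₁ : U₁) :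
    charSmall₁ t M A₁ A₂ h hne (g, u₁) = charV t M A₁ A₂ h hne g * char₁ t M A₁ A₂ h hne u₁ := by
  rw [charSmall₁_apply, charV_apply, char₁_apply, ← map_mul, Prod.mk_mul_mk, Prod.mk_mul_mk, mul_one,
    one_mul, mul_one]

/-- Unfolding. [folklore] -/
@[simp] theorem charSmall₂_apply (g : GV) (u₂ : U₂) :
    charSmall₂ t M A₁ A₂ h hne (g, u₂) = seesawScalarChar t M A₁ A₂ h hne (1, (1, u₂)) := rfl

/-- **On the nose, scheme (small)**: keep the big representation `M`; twist `A₁` by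
`(g,u₁) ↦ λV g · λ₁ u₁` and `A₂` by `(g,u₂) ↦ λ₂ u₂`.  Then for ALL `g, u₁, u₂, a, b`:
`M (g,(u₁,u₂)) (t a b) = t (A₁′ (g,u₁) a) (A₂′ (g,u₂) b)`. [folklore] -/
theorem seesaw_restrict_twist_small (g : GV) (u₁ : U₁) (u₂ : U₂) (a : S₁) (b : S₂) :
    M (g, (u₁, u₂)) (t a b) =
      t (twist (charSmall₁ t M A₁ A₂ h hne) A₁ (g, u₁) a)
        (twist (charSmall₂ t M A₁ A₂ h hne) A₂ (g, u₂) b) := by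
  rw [twist_apply, twist_apply, LinearMap.map_smul₂, LinearMap.map_smul, smul_smul,
    charSmall₁_apply, charSmall₂_apply, ← Units.val_mul, ← map_mul]
  simp only [Prod.mk_mul_mk, mul_one, one_mul]
  exact seesawScalarChar_spec t M A₁ A₂ h hne g u₁ u₂ a b

/-- The character of the big representation under scheme (big): `(g,(u₁,u₂)) ↦ λV g`, to be inverted.
[folklore] -/
noncomputable def charBigV : GV × (U₁ × U₂) →* Rˣ :=
  (charV t M A₁ A₂ h hne).comp (MonoidHom.fst GV (U₁ × U₂))

/-- `(g,u₁) ↦ λ₁ u₁` on the first small pair. [folklore] -/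
noncomputable def charBig₁ : GV × U₁ →* Rˣ :=
  (char₁ t M A₁ A₂ h hne).comp (MonoidHom.snd GV U₁)

/-- Unfolding. [folklore] -/
@[simp] theorem charBigV_apply (p : GV × (U₁ × U₂)) :
    charBigV t M A₁ A₂ h hne p = charV t M A₁ A₂ h hne p.1 := rfl

/-- Unfolding. [folklore] -/
@[simp] theorem charBig₁_apply (q : GV × U₁) :
    charBig₁ t M A₁ A₂ h hne q = char₁ t M A₁ A₂ h hne q.2 := rfl

/-- **On the nose, scheme (big)** — «`s_V^W ↦ s_V^W · λV⁻¹`, `s_{W_j} ↦ s_{W_j} · λ_j`»: twist `M` by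
`λV⁻¹` on the `GV`-factor, `A₁` by `λ₁` on the `U₁`-factor, `A₂` by `λ₂` on the `U₂`-factor.  Then for ALL
`g, u₁, u₂, a, b`: `M′ (g,(u₁,u₂)) (t a b) = t (A₁′ (g,u₁) a) (A₂′ (g,u₂) b)`. [folklore] -/
theorem seesaw_restrict_twist_big (g : GV) (u₁ : U₁) (u₂ : U₂) (a : S₁) (b : S₂) :
    twist (charBigV t M A₁ A₂ h hne)⁻¹ M (g, (u₁, u₂)) (t a b) =
      t (twist (charBig₁ t M A₁ A₂ h hne) A₁ (g, u₁) a)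
        (twist (charSmall₂ t M A₁ A₂ h hne) A₂ (g, u₂) b) := by
  rw [twist_apply, twist_apply, twist_apply, LinearMap.map_smul₂, LinearMap.map_smul, smul_smul,
    seesawScalarChar_spec t M A₁ A₂ h hne g u₁ u₂ a b, smul_smul, MonoidHom.inv_apply, charBigV_apply,
    charBig₁_apply, charSmall₂_apply, ← char₂_apply, seesawScalarChar_factor, ← Units.val_mul,
    ← Units.val_mul]
  congr 2
  rw [mul_assoc, inv_mul_cancel_left]

end Seesaw

end SeesawScalar

end Literature.RepresentationTheory
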